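import Literature.NumberTheory.EllipticCurves.SelmerCorankAssembly
import Literature.NumberTheory.EllipticCurves.IwasawaTowerTorsionProofs
import Literature.NumberTheory.EllipticCurves.SubgroupSelmerProofs
import HarnessLib

/-!
# From `H¹(K, E[p])` to LEVEL 0 of a `ℤ_p`-tower: the classes of `H¹(K, E[p])` with prescribed
# local behaviour land in `A_0 = h_0⁻¹(Sel_{p^∞}(E/K_∞))`, injectively when `E(K)[p] = 0`
# (cell `b2b-bsdres`, team n1011, seat p10 GEN 4; OWNERS row T-E3g-BUD0, FILE 2 — the bridge)

HONEST FRAMING (cell `b2b-bsdres`, run/shared/lean/b2b/bsd-rank1-residual/, verbatim in every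
file): the goal of the cell is to DELETE the COMBINATION-SHAPED residual classes of the
Birch–Swinnerton-Dyer formula for ALL analytic-rank `≤ 1` elliptic curves over `ℚ` — "full BSD
formula for every rank `≤ 1` curve in class `C`" assembled STRICTLY from published theorems — so
that the rank-`≤ 1` remainder becomes exactly the CONSTRUCTION-SHAPED classes, which are TYPED
(missing-input `Prop`s), NOT attempted. This is not "finishing BSD". Team n1011 (N10/N11):
research routes on CONSTRUCTION-SHAPED classes; census output = EVIDENCE, never a Literature fact;
RESIDUAL-MAP marks UNCHANGED; nothing is booked by this file. THEOREMS ONLY (no definition, no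
named fact, nothing asserted); pure Galois-cohomology bookkeeping over ANY field / number field
`K`, any prime `p`, any `ℤ_p`-extension `κ`.

## What and why (row T-E3g-BUD0; FILE 1 = `Additive/BudgetFromRationalClasses.lean`)

FILE 1 turned the Route-G budget `BudgetLeLambdaAt p W b` into a LEVEL-`n` input: a finite set
of `≥ p^b` classes in `A_n[p]`, `A_n = h_n⁻¹(Sel_{p^∞}(E/K_∞)) ⊆ H¹(K_n, E[p^∞])` (the tree's
`selmerInftyPreimage κ n`). This file supplies the map by which such classes are PRODUCED at `n = 0`
from the `p`-descent cohomology `H¹(K, E[p])` of file `Selmer` (where the Kummer Selmer structure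
and the Poitou–Tate duality of the tree live), with no new object:

  `Ψ = res_{Γ_K → κ⁻¹(p⁰ℤ_p)} ∘ (E[p] ↪ E[p^∞])_* : H¹(K, E[p]) → H¹(K_0, E[p^∞])`

(the tree's `torsionToPrimaryH1` followed by `resH1Hom (subgroupIncl (κ.layerSubgroup 0)) id`).

* §1 **`(E[p] ↪ E[p^∞])_* : H¹(K, E[p]) → H¹(K, E[p^∞])` is INJECTIVE when `E(K)[p] = 0`** (the
  kernel is `E(K)[p^∞] ⊗ ℤ/p` by the cohomology sequence of `0 → E[p] → E[p^∞] →(p) E[p^∞] → 0`;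
  on cocycles: if `ι∘φ = ∂a` then `p·a ∈ E[p^∞]^{Γ_K} = 0`, so `a ∈ E[p]` and `φ = ∂a`). The
  surjection onto `H¹(K, E[p^∞])[p]` is the tree's `exists_torsionToPrimaryH1_eq`.
* §2 `res_{Γ_K → κ⁻¹(ℤ_p)}` is injective (`κ.layerSubgroup 0 = ⊤`, `bijective_resH1Hom_subgroupIncl`);
  and the local restriction of `Ψ y` at a `K`-field `E` (a completion) over the layer `K_0` is the
  restriction to the local subgroup of the image of `y` in `H¹(Γ_E, E(K̄_E))` — so a class `y` in the
  local kernel `selmerLocalKer W E p` (Kummer condition: `y` dies in `H¹(Γ_E, E(K̄_E))`) has `Ψ y`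
  in the layer-`0` local kernel `localKerOver p (κ.layerSubgroup 0) E`.
* §3 From layer-`0` local kernels to `A_0`: `h_0(z)` is fixed by every `conj_σ`
  (`range_layerToInfty_le_layerInvariants_holds` at `n = 0`), so `z ∈ A_0` iff `h_0 z` lies in the
  local kernel `localKerOver p (ker κ) K_v` for every finite `v` and every infinite `w` — ONE
  decomposition group per place; and the layer-`0` local kernel at `E` implies the `K_∞`-level one
  (`localResOverOfEmb_resOfLe`: restriction commutes with the local restrictions).
* §4 ASSEMBLY: a class `y ∈ H¹(K, E[p])` that satisfies the Kummer condition at every infinite place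
  and at every finite place outside a set `T`, and whose image satisfies the `K_∞`-LEVEL local
  condition at the places of `T` ("`y` dies in `H¹(K_{∞,η}, E)` for the prime `η ∣ v` singled out by
  the chosen embedding", the input FILE 3 discharges for unramified classes at `v ∤ p`), has
  `Ψ y ∈ A_0`, and `Ψ y` is killed by `p`.
* §5 COUNTING: a finite subgroup `S ≤ H¹(K, E[p])` of such classes gives a finite set of `#S`
  classes in `A_0[p]` when `E(K)[p] = 0` — the `hA` of FILE 1 at `n = 0` with `p ^ b ≤ #S`.

References: R. Greenberg, LNM 1716 (1999) §1 p. 62, §2, §3 pp. 85–86 (the maps `h_n`, `A_n`,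
`ker g_n`), §5 p. 114 (the sequence `0 → E[p] → E[p^∞] → E[p^∞] → 0`) [GreenbergLNM1716];
J.-P. Serre, *Galois Cohomology* I.§2.4, I.§5.1 [SerreGaloisCohomology1997].
-/

set_option autoImplicit false

noncomputable section

open scoped Classical

open WeierstrassCurve Literature.NumberTheory.EllipticCurves Literature.NumberTheory.GaloisRepresentations
  NumberField IsDedekindDomain

namespace Summit.BirchSwinnertonDyer.Rank1Residual.Additive

universe u

/-! ### §1 `(E[p] ↪ E[p^∞])_*` is injective on `H¹(K, ·)` when `E(K)[p] = 0` -/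

section Injective

variable {K : Type u} [Field K] (W : WeierstrassCurve K) (p : ℕ) [hp : Fact p.Prime]

omit hp in
/-- Every class of `H¹(K, E[p])` is killed by `p` (its cocycles take values in `E[p]`). [folklore] -/
theorem smul_galH1Torsion_eq_zero (y : galH1Torsion W (p : ℤ)) : p • y = 0 := by
  obtain ⟨φ, rfl⟩ := oneCocycleClass_surjective _ y
  refine nsmul_oneCocycleClass_eq_zero φ p fun g ↦ Subtype.ext ?_
  rw [AddSubgroupClass.coe_nsmul, ZeroMemClass.coe_zero]
  exact AddSubgroup.torsionBy.nsmul_iff.mp (φ.1 g).2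

/-- **`(E[p] ↪ E[p^∞])_* : H¹(K, E[p]) → H¹(K, E[p^∞])` is injective when `E(K)` has no point of
order `p`.** If `[ι ∘ φ] = 0`, i.e. `ι(φ σ) = σ·a − a` for some `a ∈ E[p^∞]`, then
`σ·(p a) − p a = p·ι(φ σ) = 0` for all `σ`, so `p a ∈ E[p^∞]^{Γ_K}`, which vanishes when
`E(K)[p] = 0` (`eq_zero_of_forall_smul_eq`); hence `a ∈ E[p]` and `φ = ∂a` already in `E[p]`. This is
the injectivity half of the piece `E(K)[p^∞]/p → H¹(K, E[p]) → H¹(K, E[p^∞])[p] → 0` of the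
cohomology sequence of `0 → E[p] → E[p^∞] →(p) E[p^∞] → 0` (Greenberg LNM 1716 §5 p. 114; the
surjectivity half is the tree's `exists_torsionToPrimaryH1_eq`).
[cite: GreenbergLNM1716, §5 p. 114 (proof of Prop. 5.8)] -/
theorem torsionToPrimaryH1_injective_of_no_pTorsion [NumberField K]
    (hK : ∀ P : W.toAffine.Point, p • P = 0 → P = 0) :
    Function.Injective (torsionToPrimaryH1 W p) := by
  rw [injective_iff_map_eq_zero]
  intro y hy
  obtain ⟨φ, rfl⟩ := oneCocycleClass_surjective _ y
  rw [torsionToPrimaryH1_oneCocycleClass, oneCocycleClass_eq_zero_iff] at hy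
  obtain ⟨a, ha⟩ := hy
  have ha' : ∀ σ : Field.absoluteGaloisGroup K,
      AddSubgroup.inclusion (geomTorsion_le_geomPrimaryTorsion W p) (φ.1 σ) = σ • a - a :=
    fun σ ↦ ha σ
  -- `p • a` is `Γ_K`-fixed, hence zero
  have hpa : ∀ σ : Field.absoluteGaloisGroup K, σ • (p • a) = p • a := fun σ ↦ by
    rw [← sub_eq_zero, smul_comm, ← smul_sub, ← ha', ← map_nsmul,
      smul_galH1Torsion_pointwise W p φ σ, map_zero]
  have hpa0 : p • a = 0 := W.eq_zero_of_forall_smul_eq hK hpa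
  -- so `a ∈ E[p]`
  have hamem : ((a : geomPrimaryTorsion W p) : geomPoints W) ∈ geomTorsion W (p : ℤ) :=
    AddSubgroup.torsionBy.nsmul_iff.mpr (by
      rw [← AddSubgroupClass.coe_nsmul, hpa0, ZeroMemClass.coe_zero])
  refine (oneCocycleClass_eq_zero_iff _ φ).mpr ⟨⟨_, hamem⟩, fun σ ↦ ?_⟩
  apply AddSubgroup.inclusion_injective (geomTorsion_le_geomPrimaryTorsion W p)
  rw [ha', map_sub]
  rfl
where
  /-- pointwise: `p • φ σ = 0` in `E[p]`. -/
  smul_galH1Torsion_pointwise (W : WeierstrassCurve K) (p : ℕ) [Fact p.Prime]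
      (φ : contOneCocycles (discreteTopRep (Field.absoluteGaloisGroup K) (geomTorsion W (p : ℤ))))
      (σ : Field.absoluteGaloisGroup K) : p • φ.1 σ = 0 := by
    apply Subtype.ext
    rw [AddSubgroupClass.coe_nsmul, ZeroMemClass.coe_zero]
    exact AddSubgroup.torsionBy.nsmul_iff.mp (φ.1 σ).2

end Injective

/-! ### §2 Restriction to the layer `K_0` and the local restrictions -/

section LayerZero

variable {K : Type u} [Field K] [NumberField K] (W : WeierstrassCurve K) (p : ℕ) [hp : Fact p.Prime]
  (κ : ZpExtension K p)

omit [NumberField K] in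
/-- Every element of `Γ_K` lies in `κ⁻¹(p⁰ ℤ_p)` (`layerSubgroup_zero`). [folklore] -/
theorem mem_layerSubgroup_zero (g : Field.absoluteGaloisGroup K) : g ∈ κ.layerSubgroup 0 := by
  rw [κ.layerSubgroup_zero]; exact Subgroup.mem_top g

omit [NumberField K] in
/-- **`res : H¹(K, E[p^∞]) → H¹(K_0, E[p^∞])` is injective** (`K_0 = K`: the subgroup
`κ⁻¹(p⁰ℤ_p)` contains every element of `Γ_K`; `bijective_resH1Hom_subgroupIncl`).
[cite: GreenbergLNM1716, §2 (Sel_E(M)_p for M = F)] -/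
theorem resH1Hom_layerSubgroup_zero_injective :
    Function.Injective (resH1Hom (subgroupIncl (κ.layerSubgroup 0))
      (AddMonoidHom.id (geomPrimaryTorsion W p)) (fun _ _ ↦ rfl)) :=
  (bijective_resH1Hom_subgroupIncl _ _ (mem_layerSubgroup_zero p κ)).injective

variable {E : Type u} [Field E] [Algebra K E]

omit [NumberField K] in
/-- **The local restriction over `K_0` after `res : H¹(Γ_K, ·) → H¹(κ⁻¹(ℤ_p), ·)`**: for
`c ∈ H¹(K, E[p^∞])` and a `K`-field `E`, `localResOver p (κ.layerSubgroup 0) E (res c)` is the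
restriction to the local subgroup `(Γ_E → Γ_K)⁻¹(κ⁻¹(ℤ_p)) ≤ Γ_E` of the image of `c` in
`H¹(Γ_E, E(K̄_E))` (both are the map of the same compatible pair; the `⊤`-version is the tree's
`localResOver_top_resH1Hom_subgroupIncl`). [cite: GreenbergLNM1716, §2] -/
theorem localResOver_layerZero_resH1Hom_subgroupIncl (c : W.galH1Primary p) :
    W.localResOver p (κ.layerSubgroup 0) E
        (resH1Hom (subgroupIncl (κ.layerSubgroup 0))
          (AddMonoidHom.id (geomPrimaryTorsion W p)) (fun _ _ ↦ rfl) c) =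
      resH1Hom (subgroupIncl (localSubgroup (κ.layerSubgroup 0) E))
        (AddMonoidHom.id (localPoints W E)) (fun _ _ ↦ rfl)
        (resH1Hom (resGal (K := K) E) ((pointsMap W E).comp (geomPrimaryTorsion W p).subtype)
          (W.pointsMap_comp_subtype_smul p) c) := by
  show resH1Hom (resGalSubgroupOfEmb (κ.layerSubgroup 0) (closureEmb (K := K) E))
      ((pointsMapOfEmb W (closureEmb (K := K) E)).comp (geomPrimaryTorsion W p).subtype)
      (W.pointsMapOfEmb_comp_subtype_smul p (closureEmb (K := K) E) (κ.layerSubgroup 0))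
      (resH1Hom (subgroupIncl (κ.layerSubgroup 0))
        (AddMonoidHom.id (geomPrimaryTorsion W p)) (fun _ _ ↦ rfl) c) = _
  rw [resH1Hom_resH1Hom, resH1Hom_resH1Hom]
  exact DFunLike.congr_fun (resH1Hom_congr (by ext; rfl) (by ext; rfl) _ _) c

omit [NumberField K] in
/-- **Kummer condition at `E` ⟹ layer-`0` local kernel at `E`.** If `c ∈ H¹(K, E[p^∞])` dies in
`H¹(Γ_E, E(K̄_E))` (`selmerLocalKerPrimary W E p`) then `res c ∈ H¹(K_0, E[p^∞])` lies in
`localKerOver p (κ.layerSubgroup 0) E`. [cite: GreenbergLNM1716, §2] -/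
theorem resH1Hom_mem_localKerOver_layerZero_of_mem_selmerLocalKerPrimary {c : W.galH1Primary p}
    (hc : c ∈ selmerLocalKerPrimary W E p) :
    resH1Hom (subgroupIncl (κ.layerSubgroup 0)) (AddMonoidHom.id (geomPrimaryTorsion W p))
        (fun _ _ ↦ rfl) c ∈ W.localKerOver p (κ.layerSubgroup 0) E := by
  rw [mem_localKerOver_iff, localResOver_layerZero_resH1Hom_subgroupIncl,
    (W.mem_selmerLocalKerPrimary_iff p c).mp hc, map_zero]

omit [NumberField K] hp in
/-- **`(E[p] ↪ E[p^∞])_*` respects the local kernels**: `y ∈ H¹(K, E[p])` dies in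
`H¹(Γ_E, E(K̄_E))` iff its image in `H¹(K, E[p^∞])` does (both are the map of the pair
`(Γ_E → Γ_K, E[p] ↪ E(K̄) → E(K̄_E))`; functoriality). [folklore] -/
theorem torsionToPrimaryH1_mem_selmerLocalKerPrimary_iff (y : galH1Torsion W (p : ℤ)) :
    torsionToPrimaryH1 W p y ∈ selmerLocalKerPrimary W E p ↔ y ∈ selmerLocalKer W E (p : ℤ) := by
  rw [W.mem_selmerLocalKerPrimary_iff p, selmerLocalKer, resKer_eq_ker, AddMonoidHom.mem_ker,
    torsionToPrimaryH1, resH1Hom_resH1Hom]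
  exact Iff.of_eq (congrArg (· = 0)
    (DFunLike.congr_fun (resH1Hom_congr (by ext; rfl) (by ext; rfl) _ _) y))

end LayerZero

/-! ### §3 From layer-`0` local kernels to `A_0 = h_0⁻¹(Sel_{p^∞}(E/K_∞))` -/

section ToAZero

variable {K : Type u} [Field K] [NumberField K] (W : WeierstrassCurve K) (p : ℕ) [hp : Fact p.Prime]
  (κ : ZpExtension K p)

/-- `h_0 z` is fixed by every conjugation `conj_σ`, `σ ∈ Γ_K` (the image of `h_n` is fixed by
`κ⁻¹(pⁿℤ_p)`, `range_layerToInfty_le_layerInvariants_holds`, and `κ⁻¹(ℤ_p) = Γ_K`).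
[cite: GreenbergLNM1716, §1 Thm. 1.2 and §3 p. 86] -/
theorem conjH1_layerToInfty_zero (z : W.subgroupH1 p (κ.layerSubgroup 0))
    (σ : Field.absoluteGaloisGroup K) :
    W.conjH1 p κ.kerSubgroup σ (W.layerToInfty κ 0 z) = W.layerToInfty κ 0 z :=
  (W.mem_layerInvariants_iff κ 0 _).mp
    (W.range_layerToInfty_le_layerInvariants_holds κ 0 ⟨z, rfl⟩) σ (mem_layerSubgroup_zero p κ σ)

/-- **Membership in `A_0`, one decomposition group per place**: `z ∈ A_0 = h_0⁻¹(Sel_∞)` iff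
`h_0 z` lies in the local kernel `localKerOver p (ker κ) K_v` for every finite `v` and in
`localKerOver p (ker κ) K_w` for every infinite `w` (the conjugates in the definition of
`Sel_{p^∞}(E/K_∞)` are absorbed by `conjH1_layerToInfty_zero`). [cite: GreenbergLNM1716, §2 and §3 p. 85] -/
theorem mem_selmerInftyPreimage_zero_iff (z : W.subgroupH1 p (κ.layerSubgroup 0)) :
    z ∈ W.selmerInftyPreimage κ 0 ↔
      (∀ v : HeightOneSpectrum (𝓞 K),
          W.layerToInfty κ 0 z ∈ W.localKerOver p κ.kerSubgroup (v.adicCompletion K)) ∧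
        ∀ w : InfinitePlace K, W.layerToInfty κ 0 z ∈ W.localKerOver p κ.kerSubgroup w.Completion := by
  rw [W.mem_selmerInftyPreimage_iff κ 0 z]
  change W.layerToInfty κ 0 z ∈ W.selmerGroupOver p κ.kerSubgroup ↔ _
  rw [W.mem_selmerGroupOver_iff p κ.kerSubgroup]
  simp only [conjH1_layerToInfty_zero]
  exact ⟨fun h ↦ ⟨fun v ↦ h.1 v 1, fun w ↦ h.2 w 1⟩, fun h ↦ ⟨fun v _ ↦ h.1 v, fun w _ ↦ h.2 w⟩⟩

variable {E : Type u} [Field E] [Algebra K E]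

omit [NumberField K] in
/-- **Layer-`0` local kernel ⟹ `K_∞`-level local kernel**: if `z ∈ H¹(K_0, E[p^∞])` dies in
`H¹((Γ_E → Γ_K)⁻¹(κ⁻¹ℤ_p), E(K̄_E))` then `h_0 z` dies in `H¹((Γ_E → Γ_K)⁻¹(ker κ), E(K̄_E))`
(restriction commutes with the local restrictions, `localResOverOfEmb_resOfLe`).
[cite: GreenbergLNM1716, §3 (the commutative diagram, p. 86)] -/
theorem layerToInfty_zero_mem_localKerOver_of_mem {z : W.subgroupH1 p (κ.layerSubgroup 0)}
    (hz : z ∈ W.localKerOver p (κ.layerSubgroup 0) E) :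
    W.layerToInfty κ 0 z ∈ W.localKerOver p κ.kerSubgroup E := by
  rw [mem_localKerOver_iff] at hz ⊢
  change W.localResOverOfEmb p κ.kerSubgroup (closureEmb (K := K) E)
    (W.resOfLe p (κ.kerSubgroup_le_layerSubgroup 0) z) = 0
  rw [W.localResOverOfEmb_resOfLe p (closureEmb (K := K) E) (κ.kerSubgroup_le_layerSubgroup 0) z]
  change Literature.NumberTheory.EllipticCurves.resOfLe (localPoints W E) _
    (W.localResOver p (κ.layerSubgroup 0) E z) = 0
  rw [hz, map_zero]

end ToAZero

/-! ### §4 Assembly: `Ψ y ∈ A_0[p]` for `y ∈ H¹(K, E[p])` with the right local behaviour -/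

section Assembly

variable {K : Type u} [Field K] [NumberField K] (W : WeierstrassCurve K) (p : ℕ) [hp : Fact p.Prime]
  (κ : ZpExtension K p)

/-- **`Ψ y ∈ A_0`.** Let `y ∈ H¹(K, E[p])` satisfy the KUMMER local condition (`y` dies in
`H¹(Γ_{K_v}, E(K̄_v))`) at every infinite place and at every finite place outside a set `T`, and
suppose that at the places of `T` the image `h_0(Ψ y)` lies in the `K_∞`-level local kernel
`localKerOver p (ker κ) K_v` (the input of FILE 3: e.g. `y` unramified at `v ∤ p`). Then
`Ψ y = res_{K_0}((E[p] ↪ E[p^∞])_* y) ∈ A_0 = h_0⁻¹(Sel_{p^∞}(E/K_∞))`.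
[cite: GreenbergLNM1716, §2 and §3 pp. 85–86] -/
theorem resH1Hom_torsionToPrimaryH1_mem_selmerInftyPreimage_zero (y : galH1Torsion W (p : ℤ))
    (T : Set (HeightOneSpectrum (𝓞 K)))
    (hfin : ∀ v : HeightOneSpectrum (𝓞 K), v ∉ T → y ∈ selmerLocalKer W (v.adicCompletion K) (p : ℤ))
    (hinf : ∀ w : InfinitePlace K, y ∈ selmerLocalKer W w.Completion (p : ℤ))
    (hT : ∀ v ∈ T, W.layerToInfty κ 0
        (resH1Hom (subgroupIncl (κ.layerSubgroup 0)) (AddMonoidHom.id (geomPrimaryTorsion W p))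
          (fun _ _ ↦ rfl) (torsionToPrimaryH1 W p y)) ∈
        W.localKerOver p κ.kerSubgroup (v.adicCompletion K)) :
    resH1Hom (subgroupIncl (κ.layerSubgroup 0)) (AddMonoidHom.id (geomPrimaryTorsion W p))
        (fun _ _ ↦ rfl) (torsionToPrimaryH1 W p y) ∈ W.selmerInftyPreimage κ 0 := by
  rw [mem_selmerInftyPreimage_zero_iff]
  refine ⟨fun v ↦ ?_, fun w ↦ ?_⟩
  · by_cases hv : v ∈ T
    · exact hT v hv
    · exact layerToInfty_zero_mem_localKerOver_of_mem W p κ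
        (resH1Hom_mem_localKerOver_layerZero_of_mem_selmerLocalKerPrimary W p κ
          ((torsionToPrimaryH1_mem_selmerLocalKerPrimary_iff W p y).mpr (hfin v hv)))
  · exact layerToInfty_zero_mem_localKerOver_of_mem W p κ
      (resH1Hom_mem_localKerOver_layerZero_of_mem_selmerLocalKerPrimary W p κ
        ((torsionToPrimaryH1_mem_selmerLocalKerPrimary_iff W p y).mpr (hinf w)))

/-- **Selmer classes go to `A_0`** (`T = ∅`): the `p`-Selmer group `Sel^(p)(E/K)` maps into `A_0`
under `Ψ`. [cite: GreenbergLNM1716, §2 and §3 p. 85] -/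
theorem resH1Hom_torsionToPrimaryH1_mem_selmerInftyPreimage_zero_of_mem_selmerGroup
    {y : galH1Torsion W (p : ℤ)} (hy : y ∈ selmerGroup W (p : ℤ)) :
    resH1Hom (subgroupIncl (κ.layerSubgroup 0)) (AddMonoidHom.id (geomPrimaryTorsion W p))
        (fun _ _ ↦ rfl) (torsionToPrimaryH1 W p y) ∈ W.selmerInftyPreimage κ 0 := by
  rw [mem_selmerGroup_iff] at hy
  exact resH1Hom_torsionToPrimaryH1_mem_selmerInftyPreimage_zero W p κ y ∅
    (fun v _ ↦ hy.1 v) hy.2 (fun _ h ↦ absurd h (Set.notMem_empty _))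

/-- `Ψ` is injective when `E(K)[p] = 0` (§1 and §2). [cite: GreenbergLNM1716, §5 p. 114 and §2] -/
theorem resH1Hom_torsionToPrimaryH1_injective_of_no_pTorsion
    (hK : ∀ P : W.toAffine.Point, p • P = 0 → P = 0) :
    Function.Injective fun y : galH1Torsion W (p : ℤ) ↦
      resH1Hom (subgroupIncl (κ.layerSubgroup 0)) (AddMonoidHom.id (geomPrimaryTorsion W p))
        (fun _ _ ↦ rfl) (torsionToPrimaryH1 W p y) :=
  (resH1Hom_layerSubgroup_zero_injective W p κ).comp
    (torsionToPrimaryH1_injective_of_no_pTorsion W p hK)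

omit [NumberField K] in
/-- `Ψ y` is killed by `p` (so is `y`). [folklore] -/
theorem smul_resH1Hom_torsionToPrimaryH1_eq_zero (y : galH1Torsion W (p : ℤ)) :
    p • resH1Hom (subgroupIncl (κ.layerSubgroup 0)) (AddMonoidHom.id (geomPrimaryTorsion W p))
        (fun _ _ ↦ rfl) (torsionToPrimaryH1 W p y) = 0 := by
  rw [← map_nsmul, ← map_nsmul, smul_galH1Torsion_eq_zero, map_zero, map_zero]

end Assembly

/-! ### §5 Counting: a finite subgroup of admissible classes gives `#S` classes in `A_0[p]` -/

section Counting

variable {K : Type u} [Field K] [NumberField K] (W : WeierstrassCurve K) (p : ℕ) [hp : Fact p.Prime]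
  (κ : ZpExtension K p)

/-- **The level-`0` count from a finite subgroup of `H¹(K, E[p])`.** Let `S ≤ H¹(K, E[p])` be a
finite subgroup all of whose classes satisfy the hypotheses of
`resH1Hom_torsionToPrimaryH1_mem_selmerInftyPreimage_zero` (Kummer outside `T` and at `∞`, the
`K_∞`-level condition on `T`), and assume `E(K)[p] = 0`. Then `A_0[p]` contains a finite set of
`#S` classes — the input `hA` of `budgetLeLambdaAt_of_prop414_of_layerClasses` (FILE 1) at `n = 0`
whenever `p ^ b ≤ #S`. [cite: GreenbergLNM1716, §3 pp. 85–86 and §5 p. 114] -/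
theorem exists_finset_torsion_selmerInftyPreimage_zero_card_eq
    (hK : ∀ P : W.toAffine.Point, p • P = 0 → P = 0) (S : AddSubgroup (galH1Torsion W (p : ℤ)))
    [Finite S] (T : Set (HeightOneSpectrum (𝓞 K)))
    (hfin : ∀ y ∈ S, ∀ v : HeightOneSpectrum (𝓞 K), v ∉ T →
      y ∈ selmerLocalKer W (v.adicCompletion K) (p : ℤ))
    (hinf : ∀ y ∈ S, ∀ w : InfinitePlace K, y ∈ selmerLocalKer W w.Completion (p : ℤ))
    (hT : ∀ y ∈ S, ∀ v ∈ T, W.layerToInfty κ 0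
        (resH1Hom (subgroupIncl (κ.layerSubgroup 0)) (AddMonoidHom.id (geomPrimaryTorsion W p))
          (fun _ _ ↦ rfl) (torsionToPrimaryH1 W p y)) ∈
        W.localKerOver p κ.kerSubgroup (v.adicCompletion K)) :
    ∃ s : Finset {z : W.selmerInftyPreimage κ 0 // p • z = 0}, s.card = Nat.card S := by
  haveI : Fintype S := Fintype.ofFinite S
  let f : S → {z : W.selmerInftyPreimage κ 0 // p • z = 0} := fun y ↦
    ⟨⟨resH1Hom (subgroupIncl (κ.layerSubgroup 0)) (AddMonoidHom.id (geomPrimaryTorsion W p))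
        (fun _ _ ↦ rfl) (torsionToPrimaryH1 W p y),
      resH1Hom_torsionToPrimaryH1_mem_selmerInftyPreimage_zero W p κ y T (hfin y y.2) (hinf y y.2)
        (hT y y.2)⟩,
      Subtype.ext (by
        rw [AddSubgroup.coe_nsmul, ZeroMemClass.coe_zero]
        exact smul_resH1Hom_torsionToPrimaryH1_eq_zero W p κ y)⟩
  have hf : Function.Injective f := fun y₁ y₂ h ↦ Subtype.ext
    (resH1Hom_torsionToPrimaryH1_injective_of_no_pTorsion W p κ hK
      (congrArg (fun z : {z : W.selmerInftyPreimage κ 0 // p • z = 0} ↦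
        ((z.1 : W.selmerInftyPreimage κ 0) : W.subgroupH1 p (κ.layerSubgroup 0))) h))
  refine ⟨Finset.univ.map ⟨f, hf⟩, ?_⟩
  rw [Finset.card_map, Finset.card_univ, Nat.card_eq_fintype_card]

/-- **The level-`0` count from the `p`-Selmer group**: when `E(K)[p] = 0` and `Sel^(p)(E/K)` is
finite, `A_0[p]` contains `#Sel^(p)(E/K)` classes (`T = ∅`). For a curve of rank `r` with
`E(K)[p] = 0` this recovers the budget `b = r` of `Typed.X_pow_mordellWeilRank_dvd_of_charIdeal_eq_span`
at level `0` (`#Sel^(p) ≥ p^r`), as a sanity check of the mechanism. [cite: GreenbergLNM1716, §3 pp. 85–86] -/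
theorem exists_finset_torsion_selmerInftyPreimage_zero_card_eq_selmerGroup
    (hK : ∀ P : W.toAffine.Point, p • P = 0 → P = 0) [Finite (selmerGroup W (p : ℤ))] :
    ∃ s : Finset {z : W.selmerInftyPreimage κ 0 // p • z = 0},
      s.card = Nat.card (selmerGroup W (p : ℤ)) := by
  refine exists_finset_torsion_selmerInftyPreimage_zero_card_eq W p κ hK (selmerGroup W (p : ℤ)) ∅
    (fun y hy v _ ↦ ((mem_selmerGroup_iff W (p : ℤ) y).mp hy).1 v)
    (fun y hy w ↦ ((mem_selmerGroup_iff W (p : ℤ) y).mp hy).2 w)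
    (fun _ _ _ h ↦ absurd h (Set.notMem_empty _))

end Counting

end Summit.BirchSwinnertonDyer.Rank1Residual.Additive

end
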